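import Summits.ResolutionOfSingularities.ResolutionOfSingularities.Theorems.FrobeniusClosingSteerCriticalSurfaceDictionary
import Mathlib.RingTheory.Localization.AtPrime.Basic
import Mathlib.RingTheory.Localization.Ideal
import HarnessLib

/-!
# Crux `Steer` (stmt-ResolutionOfSingularities-16345), chain W4.1, p = 2 σ-residual, LOW half: the SQUARE UPGRADE at the critical prime
# (Σ↑) — a cleaning of `f` modulo `𝔓 + Q²` upgrades to a cleaning modulo `Q²` for every prime `Q ⊇ 𝔓 = (D₁ f, D₂ f)` (Theses-free,
# def-free)

OURS (campaign `res-hironaka`, rung L ★L-G4, slot W4.1; res-L0-w41-strat-2's §σ2.24 LOW-tower interface, sub-brick (Σ↑) of D3a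
«square upgrade at the critical prime» (HOME/STATUS 2026-08-27T09:23:21Z, «PROPOSED HAND res-type-072»; serves the interface clauses (T3)
«`h n` is not a square in `κ(𝔓)`» and (T9) «no permissible curve at a point step»); res-type-072 TAKING 09:24:25Z. Replaces the role of no
printed item; NOT a statement of the manuscript under review [claim: Hironaka2017, status: under-review]; AI review is weaker than expert
review.)

Setting: `R` a commutative ring of characteristic `2`, `f ∈ R`, two derivations `D₁, D₂` whose Jacobian matrix
`M = ((D₁ D₁ f, D₁ D₂ f), (D₂ D₁ f, D₂ D₂ f))` has UNIT determinant (in LOW SHAPE `f − g² = l₁ l₂ + c`, `c ∈ 𝔪³`, `D₁, D₂` dual to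
`l₁, l₂`, this is res-L0-w41-lead-1's `CriticalSurface.isUnit_det_jacobianPair`, p513150: `M ≡ ((0,1),(1,0)) mod 𝔪`), and
`𝔓 := (D₁ f, D₂ f)` the critical ideal.

* `mem_sq_of_mem_sq_sup_span` — **transversality of the Jacobian pair** (pure ring theory, any characteristic): for an ideal `Q ∋ e₁, e₂`
  and derivations with `det (D_i e_j)` a unit, an element `x ∈ Q² + (e₁, e₂)` with `D₁ x, D₂ x ∈ Q` lies in `Q²`. (Write
  `x = q + α e₁ + β e₂`; `D_i q ∈ Q`, so `M·(α, β)ᵀ ∈ Q × Q`; Cramer with the unit determinant gives `α, β ∈ Q`, and `α e₁ + β e₂ ∈ Q·Q`.)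
* `numerator_mem_sq_of_mem_sq_sup_critical` — characteristic `2`, `Q` PRIME containing `D₁ f, D₂ f`, `u ∉ Q`:
  `u·(s² f − a²) ∈ Q² + 𝔓 ⇒ u·(s² f − a²) ∈ Q²` (derivations kill squares: `D_i (u (s² f − a²)) = D_i u·(s² f − a²) + u s²·D_i f ∈ Q`).
* **`exists_sub_sq_mem_sq_atPrime_of_mem_map_sup`** — **(Σ↑) as res-L0-w41-strat-2 stated it**, over `R_Q = Localization.AtPrime Q` for a
  prime `Q ⊇ 𝔓`: `(∃ γ ∈ R_Q, f − γ² ∈ (𝔓 + Q²)·R_Q) → ∃ γ ∈ R_Q, f − γ² ∈ (Q R_Q)² = 𝔪_{R_Q}²` (clear denominators, apply the numerator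
  form, and return). NO regularity of `R_Q` is used; with res-type-082's `RadicandSingular.not_isRegularLocalRing_adjoinRoot_atPrime_iff`
  (p503226) the conclusion reads «`T² = f` is singular at `Q`» when `R_Q` is regular. The low-shape instances
  `…_of_lowShape` supply the unit determinant from C2's binders via lead-1's `isUnit_det_jacobianPair`.

This is the ideal-theoretic form of the (⇐) half of lead-1's dictionary `CriticalSurface.singAlongCriticalSurface` (C7, p513150), which
states the same determinant trick as «Sing(T² = f̄) at `Q̄` over `R ⧸ 𝔓` ⇒ Sing(T² = f) at `Q`»; D3a consumes the upgrade in `R` / `R_Q`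
without passing to the quotient. [cite: Matsumura1987, Thm. 14.2] [folklore]
-/

noncomputable section

-- `Summit.<S>.<S>.…` duplicates the summit name by design (single-problem summit).
set_option linter.dupNamespace false

open Polynomial IsLocalRing

namespace Summit.ResolutionOfSingularities.ResolutionOfSingularities.Theorems.SwitchingDichotomy.CriticalSurface

universe u

/-! ## (a) Transversality of the Jacobian pair: `(Q² + (e₁, e₂)) ∩ {D₁ x, D₂ x ∈ Q} ⊆ Q²` -/

section Core

variable {R : Type u} [CommRing R]

/-- **Transversality of the Jacobian pair.** Let `Q` be an ideal containing `e₁, e₂`, and `D₁, D₂` derivations such that the matrix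
`(D_i e_j)` has unit determinant. If `x ∈ Q² + (e₁, e₂)` and `D₁ x, D₂ x ∈ Q`, then `x ∈ Q²`. (Cramer: writing `x = q + α e₁ + β e₂`,
`α·det` and `β·det` lie in `Q`.) OURS. [folklore] -/
theorem mem_sq_of_mem_sq_sup_span (Q : Ideal R) (e₁ e₂ : R) (he₁ : e₁ ∈ Q) (he₂ : e₂ ∈ Q)
    (D₁ D₂ : Derivation ℤ R R) (hdet : IsUnit (D₁ e₁ * D₂ e₂ - D₁ e₂ * D₂ e₁))
    {x : R} (hx : x ∈ Q ^ 2 ⊔ Ideal.span {e₁, e₂}) (hD₁ : D₁ x ∈ Q) (hD₂ : D₂ x ∈ Q) : x ∈ Q ^ 2 := by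
  obtain ⟨q, hq, r, hr, rfl⟩ := Submodule.mem_sup.mp hx
  obtain ⟨α, β, rfl⟩ := Ideal.mem_span_pair.mp hr
  -- `D_i q ∈ Q`, hence `α D_i e₁ + β D_i e₂ ∈ Q`
  have hlin : ∀ D : Derivation ℤ R R, D (q + (α * e₁ + β * e₂)) ∈ Q → α * D e₁ + β * D e₂ ∈ Q := by
    intro D hD
    have hDq : D q ∈ Q := derivation_apply_mem_of_mem_sq D Q hq
    have hexp : D (q + (α * e₁ + β * e₂)) =
        D q + (D α * e₁ + D β * e₂) + (α * D e₁ + β * D e₂) := by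
      rw [map_add, map_add, D.leibniz, D.leibniz]
      simp only [smul_eq_mul]
      ring
    rw [hexp] at hD
    have h1 : D q + (D α * e₁ + D β * e₂) ∈ Q :=
      add_mem hDq (add_mem (Ideal.mul_mem_left _ _ he₁) (Ideal.mul_mem_left _ _ he₂))
    have := sub_mem hD h1
    rwa [add_sub_cancel_left] at this
  have h₁ := hlin D₁ hD₁
  have h₂ := hlin D₂ hD₂
  -- Cramer
  have hαdet : α * (D₁ e₁ * D₂ e₂ - D₁ e₂ * D₂ e₁) ∈ Q := by
    have e : α * (D₁ e₁ * D₂ e₂ - D₁ e₂ * D₂ e₁) =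
        (α * D₁ e₁ + β * D₁ e₂) * D₂ e₂ - (α * D₂ e₁ + β * D₂ e₂) * D₁ e₂ := by ring
    rw [e]
    exact sub_mem (Ideal.mul_mem_right _ _ h₁) (Ideal.mul_mem_right _ _ h₂)
  have hβdet : β * (D₁ e₁ * D₂ e₂ - D₁ e₂ * D₂ e₁) ∈ Q := by
    have e : β * (D₁ e₁ * D₂ e₂ - D₁ e₂ * D₂ e₁) =
        (α * D₂ e₁ + β * D₂ e₂) * D₁ e₁ - (α * D₁ e₁ + β * D₁ e₂) * D₂ e₁ := by ring
    rw [e]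
    exact sub_mem (Ideal.mul_mem_right _ _ h₂) (Ideal.mul_mem_right _ _ h₁)
  have hα : α ∈ Q := (Ideal.mul_unit_mem_iff_mem Q hdet).mp hαdet
  have hβ : β ∈ Q := (Ideal.mul_unit_mem_iff_mem Q hdet).mp hβdet
  refine add_mem hq ?_
  rw [pow_two]
  exact add_mem (Ideal.mul_mem_mul hα he₁) (Ideal.mul_mem_mul hβ he₂)

end Core

/-! ## (b) The numerator form in characteristic 2 -/

section Numerator

variable {R : Type u} [CommRing R] [CharP R 2]

/-- **Numerator form of the square upgrade** (characteristic `2`). Let `Q` be a PRIME containing `D₁ f, D₂ f`, with the Jacobian matrix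
`(D_i D_j f)` of unit determinant. If `u ∉ Q` and `u·(s² f − a²) ∈ Q² + (D₁ f, D₂ f)`, then `u·(s² f − a²) ∈ Q²`: derivations kill squares,
so `D_i (u (s² f − a²)) = D_i u·(s² f − a²) + u s²·D_i f ∈ Q`, and transversality applies. OURS. [folklore] -/
theorem numerator_mem_sq_of_mem_sq_sup_critical (f : R) (D₁ D₂ : Derivation ℤ R R)
    (hdet : IsUnit (D₁ (D₁ f) * D₂ (D₂ f) - D₁ (D₂ f) * D₂ (D₁ f)))
    (Q : Ideal R) [Q.IsPrime] (he₁ : D₁ f ∈ Q) (he₂ : D₂ f ∈ Q)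
    (u s a : R) (hu : u ∉ Q) (hx : u * (s ^ 2 * f - a ^ 2) ∈ Q ^ 2 ⊔ Ideal.span {D₁ f, D₂ f}) :
    u * (s ^ 2 * f - a ^ 2) ∈ Q ^ 2 := by
  -- `s² f − a² ∈ Q`
  have hxQ : u * (s ^ 2 * f - a ^ 2) ∈ Q := by
    have hle : Q ^ 2 ⊔ Ideal.span {D₁ f, D₂ f} ≤ Q := by
      refine sup_le (Ideal.pow_le_self two_ne_zero) ?_
      rw [Ideal.span_le]
      simp only [Set.insert_subset_iff, Set.singleton_subset_iff, SetLike.mem_coe]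
      exact ⟨he₁, he₂⟩
    exact hle hx
  have hyQ : s ^ 2 * f - a ^ 2 ∈ Q := ((Ideal.IsPrime.mem_or_mem inferInstance hxQ).resolve_left hu)
  -- `D_i (u (s² f − a²)) ∈ Q`
  have hD : ∀ D : Derivation ℤ R R, D f ∈ Q → D (u * (s ^ 2 * f - a ^ 2)) ∈ Q := by
    intro D hDf
    have hexp : D (u * (s ^ 2 * f - a ^ 2)) = D u * (s ^ 2 * f - a ^ 2) + u * (s ^ 2 * D f) := by
      rw [D.leibniz, map_sub, D.leibniz (s ^ 2) f, derivation_apply_sq, derivation_apply_sq]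
      simp only [smul_eq_mul, sub_zero]
      ring
    rw [hexp]
    exact add_mem (Ideal.mul_mem_left _ _ hyQ) (Ideal.mul_mem_left _ _ (Ideal.mul_mem_left _ _ hDf))
  exact mem_sq_of_mem_sq_sup_span Q (D₁ f) (D₂ f) he₁ he₂ D₁ D₂ hdet hx (hD D₁ he₁) (hD D₂ he₂)

/-- **(Σ↑) The square upgrade at the critical prime, localised form** (res-L0-w41-strat-2 §σ2.24: «for a prime `Q ⊇ 𝔓`,
`(∃ γ, f − γ² ∈ 𝔓 R_Q + Q² R_Q) → ∃ γ, f − γ² ∈ Q² R_Q`»). Characteristic `2`, `𝔓 = (D₁ f, D₂ f)` with unit Jacobian determinant, `Q`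
a prime containing `𝔓`, `R_Q = Localization.AtPrime Q` (no regularity needed): a cleaning of `f` into `(𝔓 + Q²)·R_Q` upgrades to a
cleaning into `𝔪_{R_Q}² = (Q R_Q)²`. Proof: write `γ = a/s`, clear denominators (`u·(s² f − a²) ∈ 𝔓 + Q²` for some `u ∉ Q`), apply the
numerator form, and divide back by the units `u, s²`. OURS. [cite: Matsumura1987, Thm. 14.2] [folklore] -/
theorem exists_sub_sq_mem_sq_atPrime_of_mem_map_sup (f : R) (D₁ D₂ : Derivation ℤ R R)
    (hdet : IsUnit (D₁ (D₁ f) * D₂ (D₂ f) - D₁ (D₂ f) * D₂ (D₁ f)))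
    (Q : Ideal R) [Q.IsPrime] (he₁ : D₁ f ∈ Q) (he₂ : D₂ f ∈ Q)
    (h : ∃ γ : Localization.AtPrime Q,
      algebraMap R (Localization.AtPrime Q) f - γ ^ 2 ∈
        (Ideal.span {D₁ f, D₂ f} ⊔ Q ^ 2).map (algebraMap R (Localization.AtPrime Q))) :
    ∃ γ : Localization.AtPrime Q,
      algebraMap R (Localization.AtPrime Q) f - γ ^ 2 ∈ maximalIdeal (Localization.AtPrime Q) ^ 2 := by
  classical
  set L := Localization.AtPrime Q with hL
  obtain ⟨γ, hγ⟩ := h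
  obtain ⟨⟨a, s⟩, rfl⟩ := IsLocalization.mk'_surjective Q.primeCompl γ
  -- the numerator `s² f − a²`
  have hs : algebraMap R L ((s : R) ^ 2 * f - a ^ 2) =
      algebraMap R L ((s : R) ^ 2) * (algebraMap R L f - IsLocalization.mk' L a s ^ 2) := by
    rw [map_sub, map_mul, mul_sub, map_pow, map_pow, ← mul_pow, IsLocalization.mk'_spec' L a s]
  have h1 : algebraMap R L ((s : R) ^ 2 * f - a ^ 2) ∈
      (Ideal.span {D₁ f, D₂ f} ⊔ Q ^ 2).map (algebraMap R L) := by
    rw [hs]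
    exact Ideal.mul_mem_left _ _ hγ
  rw [IsLocalization.algebraMap_mem_map_algebraMap_iff Q.primeCompl] at h1
  obtain ⟨u, hu, h2⟩ := h1
  have hu' : u ∉ Q := hu
  -- upgrade the numerator
  have h3 : u * ((s : R) ^ 2 * f - a ^ 2) ∈ Q ^ 2 :=
    numerator_mem_sq_of_mem_sq_sup_critical f D₁ D₂ hdet Q he₁ he₂ u s a hu' (by rwa [sup_comm] at h2)
  -- and divide back by the units `u`, `s²`
  have h4 : algebraMap R L (u * ((s : R) ^ 2 * f - a ^ 2)) ∈ maximalIdeal L ^ 2 := by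
    rw [← Localization.AtPrime.map_eq_maximalIdeal, ← Ideal.map_pow]
    exact Ideal.mem_map_of_mem _ h3
  have hunit_u : IsUnit (algebraMap R L u) := IsLocalization.map_units L ⟨u, hu⟩
  have hunit_s : IsUnit (algebraMap R L ((s : R) ^ 2)) := by
    rw [map_pow]
    exact (IsLocalization.map_units L s).pow 2
  refine ⟨IsLocalization.mk' L a s, ?_⟩
  rw [map_mul, hs, Ideal.unit_mul_mem_iff_mem _ hunit_u, Ideal.unit_mul_mem_iff_mem _ hunit_s] at h4
  exact h4

end Numerator

/-! ## (c) The low-shape instances (unit determinant from C2's binders) -/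

section LowShape

variable {R : Type u} [CommRing R] [IsRegularLocalRing R] [CharP R 2]

/-- **(Σ↑) at a LOW-SHAPE stage with dual derivations** (`f − g² = l₁ l₂ + c`, `c ∈ 𝔪³`, `D₁, D₂` dual to `l₁, l₂` — the binders of
C2 `criticalSurface`, p511593; the unit determinant is lead-1's `isUnit_det_jacobianPair`, p513150): for every prime `Q ⊇ 𝔓 = (D₁ f, D₂ f)`,
`(∃ γ ∈ R_Q, f − γ² ∈ (𝔓 + Q²) R_Q) → ∃ γ ∈ R_Q, f − γ² ∈ 𝔪_{R_Q}²`. OURS. [cite: Matsumura1987, Thm. 14.2] [folklore] -/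
theorem exists_sub_sq_mem_sq_atPrime_of_lowShape (f g l₁ l₂ c : R) (hf : f - g ^ 2 = l₁ * l₂ + c)
    (hc : c ∈ maximalIdeal R ^ 3) (D₁ D₂ : Derivation ℤ R R) (h11 : D₁ l₁ = 1) (h12 : D₁ l₂ = 0)
    (h21 : D₂ l₁ = 0) (h22 : D₂ l₂ = 1)
    (Q : Ideal R) [Q.IsPrime] (he₁ : D₁ f ∈ Q) (he₂ : D₂ f ∈ Q)
    (h : ∃ γ : Localization.AtPrime Q,
      algebraMap R (Localization.AtPrime Q) f - γ ^ 2 ∈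
        (Ideal.span {D₁ f, D₂ f} ⊔ Q ^ 2).map (algebraMap R (Localization.AtPrime Q))) :
    ∃ γ : Localization.AtPrime Q,
      algebraMap R (Localization.AtPrime Q) f - γ ^ 2 ∈ maximalIdeal (Localization.AtPrime Q) ^ 2 :=
  exists_sub_sq_mem_sq_atPrime_of_mem_map_sup f D₁ D₂
    (isUnit_det_jacobianPair f g l₁ l₂ c hf hc D₁ D₂ h11 h12 h21 h22) Q he₁ he₂ h

/-- **Numerator form at a LOW-SHAPE stage** (global elements, no localisation): for a prime `Q ∋ D₁ f, D₂ f` and `u ∉ Q`,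
`u·(s² f − a²) ∈ Q² + (D₁ f, D₂ f) ⇒ u·(s² f − a²) ∈ Q²`. OURS. [folklore] -/
theorem numerator_mem_sq_of_lowShape (f g l₁ l₂ c : R) (hf : f - g ^ 2 = l₁ * l₂ + c)
    (hc : c ∈ maximalIdeal R ^ 3) (D₁ D₂ : Derivation ℤ R R) (h11 : D₁ l₁ = 1) (h12 : D₁ l₂ = 0)
    (h21 : D₂ l₁ = 0) (h22 : D₂ l₂ = 1)
    (Q : Ideal R) [Q.IsPrime] (he₁ : D₁ f ∈ Q) (he₂ : D₂ f ∈ Q)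
    (u s a : R) (hu : u ∉ Q) (hx : u * (s ^ 2 * f - a ^ 2) ∈ Q ^ 2 ⊔ Ideal.span {D₁ f, D₂ f}) :
    u * (s ^ 2 * f - a ^ 2) ∈ Q ^ 2 :=
  numerator_mem_sq_of_mem_sq_sup_critical f D₁ D₂
    (isUnit_det_jacobianPair f g l₁ l₂ c hf hc D₁ D₂ h11 h12 h21 h22) Q he₁ he₂ u s a hu hx

/-- **The critical surface itself is singular as soon as `f` is a square modulo `𝔓`** (the instance `Q = 𝔓` of (Σ↑), for (T3) of the
LOW-tower interface: if the surface radicand `h = f mod 𝔓` were a square `(a/s)²` in `κ(𝔓)`, i.e. `u (s² f − a²) ∈ 𝔓` with `u, s ∉ 𝔓`,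
then `f − (a/s)² ∈ (𝔓 R_𝔓)²`, so — `R_𝔓` being regular — `T² = f` is SINGULAR at `𝔓` by res-type-082's criterion, and the regular
surface germ `Σ₂` is a σ_top-permissible centre). Stated with `𝔓 = (D₁ f, D₂ f)` prime (C2, dimension `4`). OURS. [folklore] -/
theorem numerator_mem_critical_sq_of_mem_critical (f g l₁ l₂ c : R) (hf : f - g ^ 2 = l₁ * l₂ + c)
    (hc : c ∈ maximalIdeal R ^ 3) (D₁ D₂ : Derivation ℤ R R) (h11 : D₁ l₁ = 1) (h12 : D₁ l₂ = 0)
    (h21 : D₂ l₁ = 0) (h22 : D₂ l₂ = 1)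
    (hprime : (Ideal.span {D₁ f, D₂ f}).IsPrime)
    (u s a : R) (hu : u ∉ Ideal.span {D₁ f, D₂ f}) (hx : u * (s ^ 2 * f - a ^ 2) ∈ Ideal.span {D₁ f, D₂ f}) :
    u * (s ^ 2 * f - a ^ 2) ∈ Ideal.span {D₁ f, D₂ f} ^ 2 :=
  haveI := hprime
  numerator_mem_sq_of_lowShape f g l₁ l₂ c hf hc D₁ D₂ h11 h12 h21 h22 (Ideal.span {D₁ f, D₂ f})
    (Ideal.subset_span (by simp)) (Ideal.subset_span (by simp)) u s a hu (Ideal.mem_sup_right hx)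

end LowShape

end Summit.ResolutionOfSingularities.ResolutionOfSingularities.Theorems.SwitchingDichotomy.CriticalSurface

end
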